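import Mathlib
import HarnessLib

/-!
# The Kuratowski–Ryll-Nardzewski measurable selection theorem

Topic `Literature/MeasureTheory/RandomSets`. Let `X` be a measurable space, `Y` a Polish space
with its Borel σ-algebra, and `Φ : X → Set Y` a correspondence (multifunction) with nonempty closed
values which is *weakly measurable*: the hit set `{x | Φ x ∩ U ≠ ∅}` is measurable for every open
`U ⊆ Y`. Then `Φ` admits a **measurable selector**, a measurable map `f : X → Y` with `f x ∈ Φ x`
for every `x` (`exists_measurable_selector`). This is the Kuratowski–Ryll-Nardzewski selection
theorem (1965) in the form of Kechris, *Classical Descriptive Set Theory*, Thm. 12.13 (equivalently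
Castaing–Valadier, LNM 580, Thm. III.6; Srivastava, GTM 180, Thm. 5.2.1).

As a corollary (`exists_measurable_selector_of_isClosed_graph`): if `X` is a topological space
whose σ-algebra contains the open sets, `Y` is a compact Polish (= compact metrizable) space and
`Φ` has nonempty values and a closed graph `{(x, y) | y ∈ Φ x}`, then `Φ` has a measurable
selector. Indeed the values are closed, for a closed `F ⊆ Y` the hit set `{x | Φ x ∩ F ≠ ∅}` is
the projection of the closed set `graph ∩ (X × F)` along the compact factor, hence closed
(`isClosedMap_fst_of_compactSpace`), and an open `U` is a countable union of closed sets. This is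
the form used to select measurably a minimiser of a jointly continuous function on a compact
fibre (e.g. an absolute minimiser of a gauge-fixing functional over a compact gauge group).

## Proof

The textbook proof (Kechris, proof of Thm. 12.13). Fix a complete compatible metric on `Y`
(`TopologicalSpace.upgradeIsCompletelyMetrizable`) and a dense sequence `(yₘ)`
(`TopologicalSpace.denseSeq`). Define measurable index maps `sₖ : X → ℕ` recursively: `s₀ x` is
the least `m` with `Φ x ∩ B(yₘ, 1) ≠ ∅`, and `sₖ₊₁ x` is the least `m` with
`Φ x ∩ B(yₘ, 2^{-(k+1)}) ∩ B(y_{sₖ x}, 2^{-k}) ≠ ∅` (`exists_measurable_refinement`; the least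
index of a measurable family of events is measurable, `measurable_find`, and the events are hit
sets of open balls intersected over the countably many values of `sₖ`,
`measurableSet_setOf_nat_param`). Then `fₖ x := y_{sₖ x}` are measurable,
`dist (fₖ x, fₖ₊₁ x) < 2^{-k} + 2^{-(k+1)}`, so `fₖ x` is Cauchy and converges to some `f x`;
`f` is measurable as a pointwise limit of measurable maps into a metrizable space
(`measurable_of_tendsto_metrizable`), and `f x ∈ Φ x` because `dist (fₖ x, Φ x) < 2^{-k}` and
`Φ x` is closed.

## Mathlib search

Mathlib (this pin) has Polish spaces and `upgradeIsCompletelyMetrizable`, `measurable_find`,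
`measurable_of_tendsto_metrizable`, Lusin–Souslin (`Continuous.measurableEmbedding`) and the
measurability of images under injective maps, but no measurable selection theorem of
Kuratowski–Ryll-Nardzewski type and no hyperspace (Effros) measurability API (searched
`selector`, `selection`, `Ryll`, `Kuratowski`, `Effros` under `Mathlib/MeasureTheory`: nothing).

## References

* A. S. Kechris, *Classical Descriptive Set Theory*, Graduate Texts in Math. 156, Springer
  (1995), Thm. 12.13 and its proof. [Kechris1995]
* K. Kuratowski, C. Ryll-Nardzewski, *A general theorem on selectors*, Bull. Acad. Polon. Sci.
  Sér. Sci. Math. Astronom. Phys. 13 (1965), 397–403 (original source; not needed here).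
* C. Castaing, M. Valadier, *Convex Analysis and Measurable Multifunctions*, Lecture Notes in
  Math. 580, Springer (1977), Thm. III.6 (same statement; not needed here).
-/

set_option autoImplicit false

noncomputable section

open Set Filter Metric TopologicalSpace
open scoped Topology

namespace Literature.MeasureTheory.RandomSets

/-! ### Measurable events parametrised by a measurable index -/

/-- If `s : X → ℕ` is measurable and `{x | q j x}` is measurable for every `j : ℕ`, then the
diagonal event `{x | q (s x) x}` is measurable (split over the countably many values of `s`).
[folklore] -/
theorem measurableSet_setOf_nat_param {X : Type*} [MeasurableSpace X] {s : X → ℕ}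
    (hs : Measurable s) {q : ℕ → X → Prop} (hq : ∀ j, MeasurableSet {x | q j x}) :
    MeasurableSet {x | q (s x) x} := by
  have : {x | q (s x) x} = ⋃ j, s ⁻¹' {j} ∩ {x | q j x} := by
    refine Subset.antisymm (fun x hx => mem_iUnion.2 ⟨s x, rfl, hx⟩) ?_
    rintro x hx
    obtain ⟨j, hj, hjx⟩ := mem_iUnion.1 hx
    obtain rfl : s x = j := hj
    exact hjx
  rw [this]
  exact MeasurableSet.iUnion fun j => (hs (measurableSet_singleton j)).inter (hq j)

/-! ### One refinement step -/

/-- **Refinement step.** Let `Φ : X → Set Y` be weakly measurable (hit sets of open sets are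
measurable), `y : ℕ → Y` a dense sequence, `r > 0`, `V : ℕ → Set Y` open sets and `s : X → ℕ`.
Then there is `s' : X → ℕ`, measurable if `s` is, such that whenever `Φ x` meets `V (s x)`, it
meets `ball (y (s' x)) r ∩ V (s x)`: take for `s' x` the least admissible index (the least index
of a measurable sequence of events is measurable). [folklore] -/
theorem exists_measurable_refinement {X Y : Type*} [MeasurableSpace X] [PseudoMetricSpace Y]
    (Φ : X → Set Y) (hmeas : ∀ U : Set Y, IsOpen U → MeasurableSet {x | (Φ x ∩ U).Nonempty})
    {y : ℕ → Y} (hy : DenseRange y) {r : ℝ} (hr : 0 < r) {V : ℕ → Set Y}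
    (hV : ∀ j, IsOpen (V j)) (s : X → ℕ) :
    ∃ s' : X → ℕ, (Measurable s → Measurable s') ∧
      ∀ x, (Φ x ∩ V (s x)).Nonempty → (Φ x ∩ (ball (y (s' x)) r ∩ V (s x))).Nonempty := by
  classical
  -- the events "`Φ x` meets `ball (y m) r ∩ V j`" are measurable in `x`
  have hc : ∀ j m : ℕ, MeasurableSet {x | (Φ x ∩ (ball (y m) r ∩ V j)).Nonempty} :=
    fun j m => hmeas _ (isOpen_ball.inter (hV j))
  -- the predicate searched by `Nat.find`, with a fallback making it always satisfiable
  have hp : ∀ x, ∃ m : ℕ, (Φ x ∩ (ball (y m) r ∩ V (s x))).Nonempty ∨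
      ∀ m' : ℕ, ¬(Φ x ∩ (ball (y m') r ∩ V (s x))).Nonempty := by
    intro x
    by_cases h : ∃ m : ℕ, (Φ x ∩ (ball (y m) r ∩ V (s x))).Nonempty
    · exact h.imp fun m hm => Or.inl hm
    · exact ⟨0, Or.inr (not_exists.1 h)⟩
  refine ⟨fun x => Nat.find (hp x), fun hs => measurable_find hp fun m => ?_, fun x hx => ?_⟩
  · have h₁ : MeasurableSet {x | (Φ x ∩ (ball (y m) r ∩ V (s x))).Nonempty} :=
      measurableSet_setOf_nat_param hs
        (q := fun j x => (Φ x ∩ (ball (y m) r ∩ V j)).Nonempty) fun j => hc j m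
    have h₂ : MeasurableSet {x | ∀ m' : ℕ, ¬(Φ x ∩ (ball (y m') r ∩ V (s x))).Nonempty} := by
      refine measurableSet_setOf_nat_param hs
        (q := fun j x => ∀ m' : ℕ, ¬(Φ x ∩ (ball (y m') r ∩ V j)).Nonempty) fun j => ?_
      simp only [setOf_forall]
      exact MeasurableSet.iInter fun m' => (hc j m').compl
    simpa only [setOf_or] using h₁.union h₂
  · obtain ⟨z, hzΦ, hzV⟩ := hx
    obtain ⟨m, hm⟩ := hy.exists_dist_lt z hr
    have hex : ∃ m : ℕ, (Φ x ∩ (ball (y m) r ∩ V (s x))).Nonempty :=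
      ⟨m, z, hzΦ, mem_ball.2 hm, hzV⟩
    rcases Nat.find_spec (hp x) with h | h
    · exact h
    · exact (not_exists.2 h hex).elim

/-! ### The selection theorem -/

/-- **Kuratowski–Ryll-Nardzewski measurable selection theorem** (Kechris, *Classical
Descriptive Set Theory*, Thm. 12.13). Let `X` be a measurable space, `Y` a Polish space with its
Borel σ-algebra and `Φ : X → Set Y` a map with nonempty closed values such that
`{x | Φ x ∩ U ≠ ∅}` is measurable for every open `U ⊆ Y` (weak measurability). Then `Φ` has a
measurable selector: a measurable `f : X → Y` with `f x ∈ Φ x` for all `x`.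
[cite: Kechris1995, Theorem 12.13] -/
theorem exists_measurable_selector {X Y : Type*} [MeasurableSpace X] [TopologicalSpace Y]
    [PolishSpace Y] [MeasurableSpace Y] [BorelSpace Y] (Φ : X → Set Y)
    (hne : ∀ x, (Φ x).Nonempty) (hcl : ∀ x, IsClosed (Φ x))
    (hmeas : ∀ U : Set Y, IsOpen U → MeasurableSet {x | (Φ x ∩ U).Nonempty}) :
    ∃ f : X → Y, Measurable f ∧ ∀ x, f x ∈ Φ x := by
  rcases isEmpty_or_nonempty X with hX | ⟨⟨x₀⟩⟩
  · exact ⟨fun x => (hX.false x).elim, Subsingleton.measurable, fun x => (hX.false x).elim⟩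
  obtain ⟨y₀, -⟩ := hne x₀
  haveI : Nonempty Y := ⟨y₀⟩
  letI := upgradeIsCompletelyMetrizable Y
  -- a dense sequence and the radii `(1/2)^k`
  have hy : DenseRange (denseSeq Y) := denseRange_denseSeq Y
  have ε_pos : ∀ k : ℕ, (0 : ℝ) < (1 / 2) ^ k := fun k => by positivity
  have ε_succ_le : ∀ k : ℕ, (1 / 2 : ℝ) ^ (k + 1) ≤ (1 / 2) ^ k := fun k =>
    pow_le_pow_of_le_one (by norm_num) (by norm_num) (Nat.le_succ k)
  have ε_lim : Tendsto (fun k : ℕ => (1 / 2 : ℝ) ^ k) atTop (𝓝 0) :=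
    tendsto_pow_atTop_nhds_zero_of_lt_one (by norm_num) (by norm_num)
  -- stage `0`: the least `m` with `Φ x ∩ ball (y m) 1 ≠ ∅`
  obtain ⟨s₀, hs₀m, hs₀⟩ : ∃ s : X → ℕ, Measurable s ∧
      ∀ x, (Φ x ∩ ball (denseSeq Y (s x)) ((1 / 2 : ℝ) ^ 0)).Nonempty := by
    obtain ⟨s, hsm, hs⟩ := exists_measurable_refinement Φ hmeas hy (ε_pos 0)
      (V := fun _ => univ) (fun _ => isOpen_univ) (fun _ => 0)
    refine ⟨s, hsm measurable_const, fun x => ?_⟩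
    simpa only [inter_univ] using hs x (by simpa only [inter_univ] using hne x)
  -- the refinement maps `F k : (X → ℕ) → (X → ℕ)` and the index sequence `seq k : X → ℕ`
  choose F hF using fun (k : ℕ) (s : X → ℕ) =>
    exists_measurable_refinement Φ hmeas hy (ε_pos (k + 1))
      (V := fun j => ball (denseSeq Y j) ((1 / 2 : ℝ) ^ k)) (fun _ => isOpen_ball) s
  let seq : ℕ → X → ℕ := fun k => Nat.rec (motive := fun _ => X → ℕ) s₀ F k
  have seq_succ : ∀ k, seq (k + 1) = F k (seq k) := fun _ => rfl
  have seq_meas : ∀ k, Measurable (seq k) := by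
    intro k
    induction k with
    | zero => exact hs₀m
    | succ k ih => rw [seq_succ]; exact (hF k (seq k)).1 ih
  have seq_inv : ∀ (k : ℕ) (x : X),
      (Φ x ∩ ball (denseSeq Y (seq k x)) ((1 / 2 : ℝ) ^ k)).Nonempty := by
    intro k
    induction k with
    | zero => exact hs₀
    | succ k ih =>
      intro x
      rw [seq_succ]
      obtain ⟨z, hzΦ, hz, -⟩ := (hF k (seq k)).2 x (ih x)
      exact ⟨z, hzΦ, hz⟩
  -- the approximating selectors `f k x := y (seq k x)`
  let f : ℕ → X → Y := fun k x => denseSeq Y (seq k x)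
  have f_meas : ∀ k, Measurable (f k) := fun k =>
    (measurable_from_nat (f := denseSeq Y)).comp (seq_meas k)
  have f_dist : ∀ (k : ℕ) (x : X), dist (f k x) (f (k + 1) x) ≤ 2 * (1 / 2 : ℝ) ^ k := by
    intro k x
    obtain ⟨z, -, hz₁, hz₂⟩ := (hF k (seq k)).2 x (seq_inv k x)
    have h₁ : dist z (f (k + 1) x) < (1 / 2 : ℝ) ^ (k + 1) := mem_ball.1 hz₁
    have h₂ : dist z (f k x) < (1 / 2 : ℝ) ^ k := mem_ball.1 hz₂
    calc dist (f k x) (f (k + 1) x) ≤ dist z (f k x) + dist z (f (k + 1) x) :=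
          dist_triangle_left _ _ _
      _ ≤ (1 / 2 : ℝ) ^ k + (1 / 2 : ℝ) ^ k := (add_lt_add h₂ (h₁.trans_le (ε_succ_le k))).le
      _ = 2 * (1 / 2 : ℝ) ^ k := (two_mul _).symm
  have f_cauchy : ∀ x, CauchySeq fun k => f k x := fun x =>
    cauchySeq_of_le_geometric (1 / 2) 2 (by norm_num) fun k => f_dist k x
  -- the selector: the pointwise limit
  choose g hg using fun x => cauchySeq_tendsto_of_complete (f_cauchy x)
  refine ⟨g, measurable_of_tendsto_metrizable f_meas (tendsto_pi_nhds.2 hg), fun x => ?_⟩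
  choose z hz using seq_inv
  have hz_lim : Tendsto (fun k => z k x) atTop (𝓝 (g x)) := by
    refine (hg x).congr_dist (squeeze_zero (fun _ => dist_nonneg) (fun k => ?_) ε_lim)
    exact (mem_ball'.1 (hz k x).2).le
  exact (hcl x).mem_of_tendsto hz_lim (Eventually.of_forall fun k => (hz k x).1)

/-! ### Corollary: closed graph into a compact metrizable space -/

/-- **Measurable selectors for closed-graph correspondences into compact metrizable spaces.**
Let `X` be a topological space with a σ-algebra containing the open sets, `Y` a compact Polish
space with its Borel σ-algebra, and `Φ : X → Set Y` a map with nonempty values and closed graph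
`{(x, y) | y ∈ Φ x}`. Then there is a measurable `f : X → Y` with `f x ∈ Φ x` for all `x`: the
values are closed, the hit set of a closed `F` is the projection of the closed set
`graph ∩ (X × F)` along the compact factor `Y`, hence closed, and an open set is a countable union
of closed sets, so the Kuratowski–Ryll-Nardzewski theorem applies. [folklore] -/
theorem exists_measurable_selector_of_isClosed_graph {X Y : Type*} [TopologicalSpace X]
    [MeasurableSpace X] [OpensMeasurableSpace X] [TopologicalSpace Y] [PolishSpace Y]
    [CompactSpace Y] [MeasurableSpace Y] [BorelSpace Y] (Φ : X → Set Y)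
    (hne : ∀ x, (Φ x).Nonempty) (hgraph : IsClosed {p : X × Y | p.2 ∈ Φ p.1}) :
    ∃ f : X → Y, Measurable f ∧ ∀ x, f x ∈ Φ x := by
  -- the values are closed
  have hcl : ∀ x, IsClosed (Φ x) := fun x => hgraph.preimage (Continuous.prodMk_right x)
  -- hit sets of closed sets are closed (projection along a compact factor)
  have hhit : ∀ F : Set Y, IsClosed F → IsClosed {x | (Φ x ∩ F).Nonempty} := by
    intro F hF
    have : {x | (Φ x ∩ F).Nonempty} =
        Prod.fst '' ({p : X × Y | p.2 ∈ Φ p.1} ∩ Prod.snd ⁻¹' F) := by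
      refine Subset.antisymm (fun x ⟨z, hzΦ, hzF⟩ => ⟨(x, z), ⟨hzΦ, hzF⟩, rfl⟩) ?_
      rintro _ ⟨⟨x, z⟩, ⟨hzΦ, hzF⟩, rfl⟩
      exact ⟨z, hzΦ, hzF⟩
    rw [this]
    exact isClosedMap_fst_of_compactSpace _ (hgraph.inter (hF.preimage continuous_snd))
  refine exists_measurable_selector Φ hne hcl fun U hU => ?_
  -- an open set is a countable union of closed sets
  letI := upgradeIsCompletelyMetrizable Y
  obtain ⟨F, hFc, -, rfl, -⟩ := hU.exists_iUnion_isClosed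
  simp only [inter_iUnion, nonempty_iUnion, setOf_exists]
  exact MeasurableSet.iUnion fun n => (hhit (F n) (hFc n)).measurableSet

/-! ### Corollary: measurable argmax selectors (measurable maximum theorem) -/

/-- For a correspondence `K : X → Set Y` with closed graph into a compact space `Y` and a closed
set `S ⊆ X × Y`, the set of parameters `x` such that `(x, y) ∈ S` for some `y ∈ K x` is closed:
it is the projection of the closed set `graph ∩ S` along the compact factor `Y`. [folklore] -/
theorem isClosed_setOf_exists_mem_of_isClosed_graph {X Y : Type*} [TopologicalSpace X]
    [TopologicalSpace Y] [CompactSpace Y] {K : X → Set Y}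
    (hgraph : IsClosed {p : X × Y | p.2 ∈ K p.1}) {S : Set (X × Y)} (hS : IsClosed S) :
    IsClosed {x | ∃ y ∈ K x, (x, y) ∈ S} := by
  have : {x | ∃ y ∈ K x, (x, y) ∈ S} = Prod.fst '' ({p : X × Y | p.2 ∈ K p.1} ∩ S) := by
    refine Subset.antisymm (fun x ⟨y, hyK, hyS⟩ => ⟨(x, y), ⟨hyK, hyS⟩, rfl⟩) ?_
    rintro _ ⟨⟨x, y⟩, ⟨hyK, hyS⟩, rfl⟩
    exact ⟨y, hyK, hyS⟩
  rw [this]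
  exact isClosedMap_fst_of_compactSpace _ (hgraph.inter hS)

/-- **Hit sets of the argmax correspondence.** Let `K : X → Set Y` have closed graph into a
compact space `Y`, let `f : X × Y → ℝ` be continuous and `F ⊆ Y` closed. Then the set of `x` whose
argmax set `{y ∈ K x | ∀ y' ∈ K x, f (x, y') ≤ f (x, y)}` meets `F` is measurable: the argmax set
meets `F` iff `K x` meets `F` and every rational level reached by `f (x, ·)` on `K x` is reached
on `K x ∩ F` (maxima over the compact sets `K x ∩ F` are attained), a countable Boolean
combination of closed sets of parameters (`isClosed_setOf_exists_mem_of_isClosed_graph`).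
[folklore] -/
theorem measurableSet_setOf_argmax_inter_nonempty {X Y : Type*} [TopologicalSpace X]
    [MeasurableSpace X] [OpensMeasurableSpace X] [TopologicalSpace Y] [CompactSpace Y]
    {K : X → Set Y} (hgraph : IsClosed {p : X × Y | p.2 ∈ K p.1}) {f : X × Y → ℝ}
    (hf : Continuous f) {F : Set Y} (hF : IsClosed F) :
    MeasurableSet {x | ({y ∈ K x | ∀ y' ∈ K x, f (x, y') ≤ f (x, y)} ∩ F).Nonempty} := by
  have hcl : ∀ x, IsClosed (K x) := fun x => hgraph.preimage (Continuous.prodMk_right x)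
  have hfx : ∀ x, Continuous fun y => f (x, y) := fun x => hf.comp (Continuous.prodMk_right x)
  have hA : ∀ {S : Set (X × Y)}, IsClosed S → MeasurableSet {x | ∃ y ∈ K x, (x, y) ∈ S} :=
    fun hS => (isClosed_setOf_exists_mem_of_isClosed_graph hgraph hS).measurableSet
  have hF' : IsClosed (Prod.snd ⁻¹' F : Set (X × Y)) := hF.preimage continuous_snd
  have hle : ∀ q : ℚ, IsClosed {p : X × Y | (q : ℝ) ≤ f p} := fun q =>
    isClosed_le continuous_const hf
  -- the key equivalence: rational levels reached on `K x` are reached on `K x ∩ F`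
  have key : ∀ x, ({y ∈ K x | ∀ y' ∈ K x, f (x, y') ≤ f (x, y)} ∩ F).Nonempty ↔
      (∃ y ∈ K x, (x, y) ∈ (Prod.snd ⁻¹' F : Set (X × Y))) ∧ ∀ q : ℚ,
        (∃ y ∈ K x, (x, y) ∈ {p : X × Y | (q : ℝ) ≤ f p}) →
          ∃ y ∈ K x, (x, y) ∈ (Prod.snd ⁻¹' F : Set (X × Y)) ∩ {p : X × Y | (q : ℝ) ≤ f p} := by
    intro x
    constructor
    · rintro ⟨y₀, ⟨hy₀K, hy₀max⟩, hy₀F⟩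
      exact ⟨⟨y₀, hy₀K, hy₀F⟩, fun q ⟨y, hyK, hqy⟩ =>
        ⟨y₀, hy₀K, hy₀F, le_trans hqy (hy₀max y hyK)⟩⟩
    · rintro ⟨⟨y₁, hy₁K, hy₁F⟩, hq⟩
      obtain ⟨y₀, ⟨hy₀K, hy₀F⟩, hmax⟩ := ((hcl x).inter hF).isCompact.exists_isMaxOn
        ⟨y₁, hy₁K, hy₁F⟩ (hfx x).continuousOn
      refine ⟨y₀, ⟨hy₀K, fun y' hy' => not_lt.1 fun hlt => ?_⟩, hy₀F⟩
      obtain ⟨q, hq₁, hq₂⟩ := exists_rat_btwn hlt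
      obtain ⟨y, hyK, hyF, hqy⟩ := hq q ⟨y', hy', hq₂.le⟩
      exact (lt_of_lt_of_le hq₁ (le_trans hqy (isMaxOn_iff.1 hmax y ⟨hyK, hyF⟩))).false
  -- hence the hit set is a countable Boolean combination of closed sets
  have hset : {x | ({y ∈ K x | ∀ y' ∈ K x, f (x, y') ≤ f (x, y)} ∩ F).Nonempty} =
      {x | ∃ y ∈ K x, (x, y) ∈ (Prod.snd ⁻¹' F : Set (X × Y))} ∩
        ⋂ q : ℚ, {x | ∃ y ∈ K x, (x, y) ∈ {p : X × Y | (q : ℝ) ≤ f p}}ᶜ ∪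
          {x | ∃ y ∈ K x,
            (x, y) ∈ (Prod.snd ⁻¹' F : Set (X × Y)) ∩ {p : X × Y | (q : ℝ) ≤ f p}} := by
    refine Set.ext fun x => (key x).trans ⟨fun h => ⟨h.1, mem_iInter.2 fun q => ?_⟩,
      fun h => ⟨h.1, fun q hq => Or.elim (mem_iInter.1 h.2 q) (fun h' => absurd hq h') id⟩⟩
    by_cases hq : ∃ y ∈ K x, (x, y) ∈ {p : X × Y | (q : ℝ) ≤ f p}
    · exact Or.inr (h.2 q hq)
    · exact Or.inl hq
  rw [hset]
  exact (hA hF').inter (MeasurableSet.iInter fun q =>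
    (hA (hle q)).compl.union (hA (hF'.inter (hle q))))

/-- **Measurable argmax selection (measurable maximum theorem).** Let `X` be a topological space
with a σ-algebra containing the open sets, `Y` a compact Polish space with its Borel σ-algebra,
`K : X → Set Y` a correspondence with nonempty values and closed graph `{(x, y) | y ∈ K x}`, and
`f : X × Y → ℝ` continuous. Then there is a measurable `g : X → Y` such that, for every `x`,
`g x ∈ K x` maximises `f (x, ·)` over `K x`. This is (the selector part of) the measurable maximum
theorem, for closed-graph constraints and jointly continuous objectives; here it is derived from
the Kuratowski–Ryll-Nardzewski theorem applied to the argmax correspondence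
`x ↦ {y ∈ K x | ∀ y' ∈ K x, f (x, y') ≤ f (x, y)}`, whose values are nonempty (maxima on the
compact slices `K x` are attained) and closed, and whose hit sets are measurable
(`measurableSet_setOf_argmax_inter_nonempty`). [cite: AliprantisBorder2006, Theorem 18.19] -/
theorem exists_measurable_argmax_selector {X Y : Type*} [TopologicalSpace X] [MeasurableSpace X]
    [OpensMeasurableSpace X] [TopologicalSpace Y] [PolishSpace Y] [CompactSpace Y]
    [MeasurableSpace Y] [BorelSpace Y] (K : X → Set Y) (hne : ∀ x, (K x).Nonempty)
    (hgraph : IsClosed {p : X × Y | p.2 ∈ K p.1}) (f : X × Y → ℝ) (hf : Continuous f) :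
    ∃ g : X → Y, Measurable g ∧ ∀ x, g x ∈ K x ∧ ∀ y ∈ K x, f (x, y) ≤ f (x, g x) := by
  have hcl : ∀ x, IsClosed (K x) := fun x => hgraph.preimage (Continuous.prodMk_right x)
  have hfx : ∀ x, Continuous fun y => f (x, y) := fun x => hf.comp (Continuous.prodMk_right x)
  -- the argmax correspondence has nonempty closed values and measurable hit sets
  have hΨne : ∀ x, ({y ∈ K x | ∀ y' ∈ K x, f (x, y') ≤ f (x, y)}).Nonempty := fun x => by
    obtain ⟨y₀, hy₀, hmax⟩ := (hcl x).isCompact.exists_isMaxOn (hne x) (hfx x).continuousOn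
    exact ⟨y₀, hy₀, isMaxOn_iff.1 hmax⟩
  have hΨcl : ∀ x, IsClosed {y ∈ K x | ∀ y' ∈ K x, f (x, y') ≤ f (x, y)} := fun x => by
    simp only [setOf_and, setOf_forall, setOf_mem_eq]
    exact (hcl x).inter (isClosed_iInter fun y' => isClosed_iInter fun _ =>
      isClosed_le continuous_const (hfx x))
  have hΨm : ∀ U : Set Y, IsOpen U →
      MeasurableSet {x | ({y ∈ K x | ∀ y' ∈ K x, f (x, y') ≤ f (x, y)} ∩ U).Nonempty} := by
    intro U hU
    -- an open set is a countable union of closed sets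
    letI := upgradeIsCompletelyMetrizable Y
    obtain ⟨F, hFc, -, rfl, -⟩ := hU.exists_iUnion_isClosed
    simp only [inter_iUnion, nonempty_iUnion, setOf_exists]
    exact MeasurableSet.iUnion fun n =>
      measurableSet_setOf_argmax_inter_nonempty hgraph hf (hFc n)
  obtain ⟨g, hg, hgΨ⟩ := exists_measurable_selector
    (fun x => {y ∈ K x | ∀ y' ∈ K x, f (x, y') ≤ f (x, y)}) hΨne hΨcl hΨm
  exact ⟨g, hg, fun x => hgΨ x⟩

/-- `IsMaxOn` form of the measurable maximum theorem `exists_measurable_argmax_selector`: a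
measurable selector `g` of the closed-graph correspondence `K` into a compact Polish space with
`g x` a maximiser of the continuous `f (x, ·)` on `K x`. [folklore] -/
theorem exists_measurable_isMaxOn_selector {X Y : Type*} [TopologicalSpace X] [MeasurableSpace X]
    [OpensMeasurableSpace X] [TopologicalSpace Y] [PolishSpace Y] [CompactSpace Y]
    [MeasurableSpace Y] [BorelSpace Y] (K : X → Set Y) (hne : ∀ x, (K x).Nonempty)
    (hgraph : IsClosed {p : X × Y | p.2 ∈ K p.1}) (f : X × Y → ℝ) (hf : Continuous f) :
    ∃ g : X → Y, Measurable g ∧ ∀ x, g x ∈ K x ∧ IsMaxOn (fun y => f (x, y)) (K x) (g x) := by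
  obtain ⟨g, hg, h⟩ := exists_measurable_argmax_selector K hne hgraph f hf
  exact ⟨g, hg, fun x => ⟨(h x).1, isMaxOn_iff.2 (h x).2⟩⟩

/-- **Measurable argmin selection.** For a closed-graph correspondence `K` with nonempty values
into a compact Polish space and a continuous `f : X × Y → ℝ`, there is a measurable `g : X → Y`
with `g x ∈ K x` minimising `f (x, ·)` over `K x` for every `x` (apply
`exists_measurable_argmax_selector` to `-f`). [folklore] -/
theorem exists_measurable_argmin_selector {X Y : Type*} [TopologicalSpace X] [MeasurableSpace X]
    [OpensMeasurableSpace X] [TopologicalSpace Y] [PolishSpace Y] [CompactSpace Y]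
    [MeasurableSpace Y] [BorelSpace Y] (K : X → Set Y) (hne : ∀ x, (K x).Nonempty)
    (hgraph : IsClosed {p : X × Y | p.2 ∈ K p.1}) (f : X × Y → ℝ) (hf : Continuous f) :
    ∃ g : X → Y, Measurable g ∧ ∀ x, g x ∈ K x ∧ ∀ y ∈ K x, f (x, g x) ≤ f (x, y) := by
  obtain ⟨g, hg, h⟩ := exists_measurable_argmax_selector K hne hgraph (fun p => -f p) hf.neg
  exact ⟨g, hg, fun x => ⟨(h x).1, fun y hy => neg_le_neg_iff.1 ((h x).2 y hy)⟩⟩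

end Literature.MeasureTheory.RandomSets
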